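import Mathlib
import Literature.AlgebraicGeometry.Resolution.CobordantGame
import Summits.ResolutionOfSingularities.ResolutionOfSingularities.Theorems.WeightedInvariantLocalWeightedDropGradedGameCylinder
import Summits.ResolutionOfSingularities.ResolutionOfSingularities.Theorems.WeightedInvariantLocalWeightedDropGradedSliceWildFrobRoot

/-!
# `WeightedInvariant.LocalWeightedDrop`: the wild slice clause — TWISTED CYLINDERS REPRODUCE UNDER SATURATED MOVES
# (the successor step of the same-rank induction), part 1

Route `ResolutionOfSingularities/WeightedInvariant`, crux `LocalWeightedDrop` (stmt-ResolutionOfSingularities-8899).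
[OURS · L1 W4.3] — res-type-060 (gen 10), WILD LIBRARY file 16 (res-L1-w43-plan-1 SEAT TABLE v12 «060 → wild library»;
OFFER 11:59:20Z).  Nothing here is a statement of the manuscript under review on ladder RESOLUTION; not a verdict on
ideator res-L1-w43-idea-1's card A.  AI proof, weaker than expert review.

## The normal form
After the wild renormalisation `Λ_q` at a frozen coordinate of minimal `p`-adic valuation (res-type-060 p524471
`subst_wildLambdaFrob_eq`) the successor `G ∈ k[[x₀..x_n, y]]` (`y = y_v` = last) and its slice `h = G|_{y=0} ∈ k[[x₀..x_n]]`
stand in the relation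

  **TC(G, h, τ, a):  `G(x, y^q) = (1 + y)ᵃ · h((1 + y)^{τᵢ} xᵢ)`**, i.e.
  `subst (frobFamily n q) G = (1 + X last)^a * subst (scaleFam τ) h`

(`scaleFam`, `frobFamily`: res-type-099 p526968 / res-type-060 p524471) — a TWISTED CYLINDER: over the purely inseparable cover
`y = ν^q` the family `y ↦ G(·, y)` is the constant family `h` up to the unit `(1+ν)ᵃ` and the diagonal scaling by powers of the
unit `λ = 1 + ν` (`λ^q = 1 + y`: the `μ_q`-torsor `λ^q = 1 + y` is the same at every level of a play).

## What is proved (every field; `(1+y)^q = 1 + y^q` is needed only for the pre-scaling of §5)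
* §1 `subst_frobFamily_cruxChart_comm` — the Frobenius cover of the idle coordinate commutes with the chart of a move
  `(id, (W, 0))` (weight `0` on `y`).
* §2 `subst_cruxChart_scaleFam` — under POINTWISE EXACT SATURATION at the exceptional point `c'` (`τⱼ = m·Wⱼ` on the
  translated coordinates, `m·Wⱼ ≤ τⱼ` on the other blown-up ones) the scaling `scaleFam τ` followed by the chart of `(W, 0)` at
  `(c', ·)` IS the chart of `W` at `c'` followed by the scaling `scaleFam τ₁`, `τ₁ = (m ; τⱼ − m·Wⱼ)` (`m` on the exceptional
  variable).
* §3 `subst_frobFamily_cruxChart_of_twistedCyl` — hence, if `h(chart^W_{c'}) = s^{a₁}·h₁`, then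
  `(G(chart^{(W,0)}_{(c',·)}))(…, y^q) = s^{a₁} · (1+y)^{a + m·a₁} · h₁(scaleFam τ₁)`.
* §4 **`isSuccessorAt_of_twistedCyl`** — every singular `s`-saturated successor `G₁` of `G` under `(id, (W,0))` at `(c', ·)`
  with exponent `A` comes from a singular `s`-saturated successor `h₁` of `h` under `(id, W)` at `c'` with the same exponent,
  and **TC(G₁, h₁, τ₁, a + m·A)**: the twisted-cylinder structure REPRODUCES one move down.  (Converse bookkeeping:
  `constantCoeff`/linear coefficients of `G₁` and `h₁` agree off the idle slot, and the idle linear coefficient of `G₁` is a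
  multiple of `h₁(0)` — `coeff_single_last_eq_zero_of_twistedCyl`.)
* Companion file `…GradedSliceTwistedSaturation` (same day): the converse bookkeeping (idle linear coefficient of `G₁` is a
  multiple of `h₁(0)`), the downstairs graded pre-scaling `xⱼ ↦ (1+y)^{Kⱼ}xⱼ` turning TC(G,h,τ,a) into TC(G',h,τ+q·K,a) together
  with the arithmetic that makes a congruence `τⱼ ≡ m·Wⱼ (mod q)` exact and dominant, and the lattice propagation
  `q ∣ τ·r on L ⇒ q ∣ τ₁·r on succLattice L W c'`.

## Why (memo L/res-type-060-w43/WILD-SLICE-CLAUSE.md §9)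
A successor point `c'` of the descended move is fixed by the twist group `μ_q` up to the new torus `𝔾_m(W)` iff
`∃ m, τⱼ ≡ m·Wⱼ (mod q)` for every translated `j`; exactly then the translation term `c'ⱼ(λ^{τⱼ − mWⱼ} − 1)` of the
trivialisation is a function of `y` and re-centres away, and the diagonal twisted structure survives (this file).  At a
non-saturated singular successor the structure degenerates to translation type (e.g. `S² + y·M²` over the rank-`0` slice `S²`,
whose resolution needs that of `M`), which is why the SAME-RANK slice transfer T3″ holds along saturated plays and only there,
while the rank-free T3‴ is a consequence of the crux in the same number of variables rather than a self-contained lemma.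
-/

set_option linter.dupNamespace false -- mandated namespace of this single-conjunct summit
set_option autoImplicit false

namespace Summit.ResolutionOfSingularities.ResolutionOfSingularities.Theorems

namespace GradedGame

open MvPowerSeries
open Literature.AlgebraicGeometry.Resolution
open Literature.AlgebraicGeometry.Resolution.FormalCoordChange (linMat)

variable {k : Type} [Field k]

/-! ## §0 Small substitution helpers -/

/-- `subst a 1 = 1`. [OURS · L1 W4.3] -/
theorem subst_one' {N M : ℕ} {a : Fin N → MvPowerSeries (Fin M) k} (ha : HasSubst a) :
    subst a (1 : MvPowerSeries (Fin N) k) = 1 := by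
  rw [← coe_substAlgHom ha, map_one]

/-- `subst a 0 = 0`. [OURS · L1 W4.3] -/
theorem subst_zero' {N M : ℕ} {a : Fin N → MvPowerSeries (Fin M) k} (ha : HasSubst a) :
    subst a (0 : MvPowerSeries (Fin N) k) = 0 := by
  rw [← coe_substAlgHom ha, map_zero]

/-- `subst a ((1 + X v)^N · F) = (1 + a v)^N · subst a F`. [OURS · L1 W4.3] -/
theorem subst_one_add_X_pow_mul {N M : ℕ} {a : Fin N → MvPowerSeries (Fin M) k} (ha : HasSubst a) (v : Fin N) (e : ℕ)
    (F : MvPowerSeries (Fin N) k) :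
    subst a ((1 + X v) ^ e * F) = (1 + a v) ^ e * subst a F := by
  rw [subst_mul ha, subst_pow ha, subst_add ha, subst_one' ha, subst_X ha]

/-- The chart of the move `(W, 0)` (weight `0` on the idle last coordinate) on an old coordinate. [OURS · L1 W4.3] -/
theorem cruxChart_snoc_zero_castSucc {n : ℕ} (W : Fin (n + 1) → ℕ) (γ : Fin (n + 1 + 1) → k) (j : Fin (n + 1)) :
    CobordantGame.cruxChart k (Fin.snoc W 0 : Fin (n + 1 + 1) → ℕ) γ (Fin.castSucc j) =
      if 0 < W j then X 0 ^ (W j) * (C (γ (Fin.castSucc j)) + X (Fin.castSucc j.succ)) else X (Fin.castSucc j.succ) := by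
  unfold CobordantGame.cruxChart
  rw [Fin.snoc_castSucc, Fin.succ_castSucc]

/-- The chart of the move `(W, 0)` on the idle last coordinate: `y ↦ y`. [OURS · L1 W4.3] -/
theorem cruxChart_snoc_zero_last {n : ℕ} (W : Fin (n + 1) → ℕ) (γ : Fin (n + 1 + 1) → k) :
    CobordantGame.cruxChart k (Fin.snoc W 0 : Fin (n + 1 + 1) → ℕ) γ (Fin.last (n + 1)) = X (Fin.last (n + 1 + 1)) := by
  unfold CobordantGame.cruxChart
  rw [Fin.snoc_last, if_neg (lt_irrefl 0), Fin.succ_last]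

/-- The chart of `W` at `c'` on an old coordinate (unfolded). [OURS · L1 W4.3] -/
theorem cruxChart_apply {n : ℕ} (W : Fin (n + 1) → ℕ) (c' : Fin (n + 1) → k) (j : Fin (n + 1)) :
    CobordantGame.cruxChart k W c' j = if 0 < W j then X 0 ^ (W j) * (C (c' j) + X j.succ) else X j.succ := rfl

/-! ## §1 The Frobenius cover of the idle coordinate commutes with the chart of `(id, (W, 0))` -/

section Comm

variable {n : ℕ} (q : ℕ) (W : Fin (n + 1) → ℕ) (γ : Fin (n + 1 + 1) → k)

/-- `frobFamily` off the idle slot is the identity. [OURS · L1 W4.3] -/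
theorem frobFamily_of_ne_last (m : ℕ) (i : Fin (m + 1 + 1)) (hi : i ≠ Fin.last (m + 1)) :
    frobFamily (k := k) m q i = X i := by
  unfold frobFamily; rw [Function.update_of_ne hi]

/-- `frobFamily` at the idle slot is `y ↦ y^q`. [OURS · L1 W4.3] -/
theorem frobFamily_last (m : ℕ) : frobFamily (k := k) m q (Fin.last (m + 1)) = X (Fin.last (m + 1)) ^ q := by
  unfold frobFamily; rw [Function.update_self]

/-- **`Frob ∘ chart = chart ∘ Frob`** for the move `(id, (W, 0))`: the Frobenius cover of the idle coordinate commutes with the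
chart at every exceptional point. [OURS · L1 W4.3] -/
theorem subst_frobFamily_cruxChart_comm (hq : 0 < q) (F : MvPowerSeries (Fin (n + 1 + 1)) k) :
    subst (frobFamily (k := k) (n + 1) q) (subst (CobordantGame.cruxChart k (Fin.snoc W 0 : Fin (n + 1 + 1) → ℕ) γ) F) =
      subst (CobordantGame.cruxChart k (Fin.snoc W 0 : Fin (n + 1 + 1) → ℕ) γ) (subst (frobFamily (k := k) n q) F) := by
  have hC := hasSubst_cruxChart (k := k) (Fin.snoc W 0 : Fin (n + 1 + 1) → ℕ) γ
  have hF := hasSubst_frobFamily (k := k) (n := n) q hq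
  have hF' := hasSubst_frobFamily (k := k) (n := n + 1) q hq
  rw [subst_comp_subst_apply hC hF', subst_comp_subst_apply hF hC]
  congr 1
  funext i
  refine Fin.lastCases ?_ (fun j => ?_) i
  · rw [cruxChart_snoc_zero_last, frobFamily_last, subst_X hF', frobFamily_last, subst_pow hC, subst_X hC,
      cruxChart_snoc_zero_last]
  · rw [frobFamily_of_ne_last q n _ (Fin.castSucc_lt_last j).ne, subst_X hC, cruxChart_snoc_zero_castSucc]
    have h0 : frobFamily (k := k) (n + 1) q 0 = X 0 :=
      frobFamily_of_ne_last q (n + 1) 0 (Fin.castSucc_lt_last (0 : Fin (n + 1 + 1))).ne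
    have hj : frobFamily (k := k) (n + 1) q (Fin.castSucc j.succ) = X (Fin.castSucc j.succ) :=
      frobFamily_of_ne_last q (n + 1) _ (Fin.castSucc_lt_last _).ne
    by_cases hw : 0 < W j
    · rw [if_pos hw, subst_mul hF', subst_pow hF', subst_add hF', subst_C, subst_X hF', subst_X hF', h0, hj]
    · rw [if_neg hw, subst_X hF', hj]

end Comm

/-! ## §2 Under exact pointwise saturation the scaling and the chart commute up to the new scaling `τ₁` -/

section Sat

variable {n : ℕ} (τ : Fin (n + 1) → ℕ) (W : Fin (n + 1) → ℕ) (γ : Fin (n + 1 + 1) → k) (m : ℕ)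

/-- The new twist exponents after a saturated move: `m` on the exceptional variable, `τⱼ − m·Wⱼ` on the old ones (`= 0` on the
translated coordinates, `= τⱼ` on the coordinates of weight `0`). [OURS · L1 W4.3] -/
def succTau : Fin (n + 1 + 1) → ℕ := Fin.cons m fun j => τ j - m * W j

/-- `succTau` on the exceptional variable. [OURS · L1 W4.3] -/
@[simp] theorem succTau_zero : succTau τ W m 0 = m := by simp [succTau]

/-- `succTau` on an old variable. [OURS · L1 W4.3] -/
@[simp] theorem succTau_succ (j : Fin (n + 1)) : succTau τ W m j.succ = τ j - m * W j := by simp [succTau]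

/-- `scaleFam` on the exceptional variable of the successor. [OURS · L1 W4.3] -/
theorem scaleFam_succTau_zero :
    scaleFam (k := k) (succTau τ W m) 0 = (1 + X (Fin.last (n + 1 + 1))) ^ m * X 0 := by
  unfold scaleFam; rw [succTau_zero, Fin.castSucc_zero]

/-- `scaleFam` on an old variable of the successor. [OURS · L1 W4.3] -/
theorem scaleFam_succTau_succ (j : Fin (n + 1)) :
    scaleFam (k := k) (succTau τ W m) j.succ = (1 + X (Fin.last (n + 1 + 1))) ^ (τ j - m * W j) * X (Fin.castSucc j.succ) := by
  unfold scaleFam; rw [succTau_succ]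

/-- `scaleFam` unfolded at one index. [OURS · L1 W4.3] -/
theorem scaleFam_apply {M : ℕ} (σ : Fin M → ℕ) (i : Fin M) :
    scaleFam (k := k) σ i = (1 + X (Fin.last M)) ^ (σ i) * X (Fin.castSucc i) := rfl

/-- **SCALING THEN CHART = CHART THEN NEW SCALING** under exact pointwise saturation at `c' = C|_{old}`:
`τⱼ = m·Wⱼ` on the translated coordinates (`c'ⱼ ≠ 0 < Wⱼ`) and `m·Wⱼ ≤ τⱼ` on the blown-up ones. [OURS · L1 W4.3] -/
theorem subst_cruxChart_scaleFam
    (hsat : ∀ j, γ (Fin.castSucc j) ≠ 0 → 0 < W j → τ j = m * W j) (hdom : ∀ j, 0 < W j → m * W j ≤ τ j) (j : Fin (n + 1)) :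
    subst (CobordantGame.cruxChart k (Fin.snoc W 0 : Fin (n + 1 + 1) → ℕ) γ) (scaleFam (k := k) τ j) =
      subst (scaleFam (k := k) (succTau τ W m)) (CobordantGame.cruxChart k W (fun l => γ (Fin.castSucc l)) j) := by
  have hC := hasSubst_cruxChart (k := k) (Fin.snoc W 0 : Fin (n + 1 + 1) → ℕ) γ
  have hS := hasSubst_scaleFam (k := k) (succTau τ W m)
  rw [scaleFam_apply, subst_mul hC, subst_pow hC, subst_add hC, subst_one' hC, subst_X hC, subst_X hC, cruxChart_snoc_zero_last,
    cruxChart_snoc_zero_castSucc, cruxChart_apply]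
  by_cases hw : 0 < W j
  · rw [if_pos hw, if_pos hw, subst_mul hS, subst_pow hS, subst_add hS, subst_C, subst_X hS, subst_X hS]
    change _ = (scaleFam (succTau τ W m) 0) ^ W j * (C (γ (Fin.castSucc j)) + scaleFam (succTau τ W m) j.succ)
    rw [scaleFam_succTau_zero, scaleFam_succTau_succ]
    by_cases hc : γ (Fin.castSucc j) = 0
    · rw [hc, map_zero, zero_add, zero_add, mul_pow, ← pow_mul]
      have : τ j = m * W j + (τ j - m * W j) := (Nat.add_sub_cancel' (hdom j hw)).symm
      conv_lhs => rw [this, pow_add]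
      ring
    · rw [hsat j hc hw, Nat.sub_self, pow_zero, one_mul, mul_pow, ← pow_mul, mul_assoc]
  · rw [if_neg hw, if_neg hw, subst_X hS, scaleFam_succTau_succ, Nat.eq_zero_of_not_pos hw, mul_zero, Nat.sub_zero]

/-- The same, on a whole series: `(h(scaleFam τ))(chart^{(W,0)}) = (h(chart^W_{c'}))(scaleFam τ₁)`. [OURS · L1 W4.3] -/
theorem subst_cruxChart_subst_scaleFam
    (hsat : ∀ j, γ (Fin.castSucc j) ≠ 0 → 0 < W j → τ j = m * W j) (hdom : ∀ j, 0 < W j → m * W j ≤ τ j)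
    (h : MvPowerSeries (Fin (n + 1)) k) :
    subst (CobordantGame.cruxChart k (Fin.snoc W 0 : Fin (n + 1 + 1) → ℕ) γ) (subst (scaleFam (k := k) τ) h) =
      subst (scaleFam (k := k) (succTau τ W m)) (subst (CobordantGame.cruxChart k W (fun l => γ (Fin.castSucc l))) h) := by
  rw [subst_comp_subst_apply (hasSubst_scaleFam τ) (hasSubst_cruxChart _ _),
    subst_comp_subst_apply (hasSubst_cruxChart _ _) (hasSubst_scaleFam _)]
  congr 1
  funext j
  exact subst_cruxChart_scaleFam τ W γ m hsat hdom j

end Sat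

/-! ## §3 The chart identity for a twisted cylinder -/

section Identity

variable {n : ℕ} (q : ℕ) (τ : Fin (n + 1) → ℕ) (a : ℕ) (W : Fin (n + 1) → ℕ) (γ : Fin (n + 1 + 1) → k) (m : ℕ)

/-- **THE CHART IDENTITY.**  From TC(G, h, τ, a) and the chart factorisation `h(chart^W_{c'}) = s^{a₁}·h₁` of the slice, under
exact pointwise saturation: `(G(chart^{(W,0)}_{(c',·)}))(…, y^q) = s^{a₁} · ((1+y)^{a + m·a₁} · h₁(scaleFam τ₁))`.
[OURS · L1 W4.3] -/
theorem subst_frobFamily_cruxChart_of_twistedCyl (hq : 0 < q)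
    (h : MvPowerSeries (Fin (n + 1)) k) (G : MvPowerSeries (Fin (n + 1 + 1)) k)
    (hTC : subst (frobFamily (k := k) n q) G = (1 + X (Fin.last (n + 1))) ^ a * subst (scaleFam (k := k) τ) h)
    (hsat : ∀ j, γ (Fin.castSucc j) ≠ 0 → 0 < W j → τ j = m * W j) (hdom : ∀ j, 0 < W j → m * W j ≤ τ j)
    (a₁ : ℕ) (h₁ : MvPowerSeries (Fin (n + 1 + 1)) k)
    (hh : subst (CobordantGame.cruxChart k W (fun l => γ (Fin.castSucc l))) h = X 0 ^ a₁ * h₁) :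
    subst (frobFamily (k := k) (n + 1) q) (subst (CobordantGame.cruxChart k (Fin.snoc W 0 : Fin (n + 1 + 1) → ℕ) γ) G) =
      X 0 ^ a₁ * ((1 + X (Fin.last (n + 1 + 1))) ^ (a + m * a₁) * subst (scaleFam (k := k) (succTau τ W m)) h₁) := by
  have hC := hasSubst_cruxChart (k := k) (Fin.snoc W 0 : Fin (n + 1 + 1) → ℕ) γ
  have hS := hasSubst_scaleFam (k := k) (succTau τ W m)
  rw [subst_frobFamily_cruxChart_comm q W γ hq, hTC, subst_one_add_X_pow_mul hC, cruxChart_snoc_zero_last,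
    subst_cruxChart_subst_scaleFam τ W γ m hsat hdom, hh, subst_mul hS, subst_pow hS, subst_X hS, scaleFam_succTau_zero]
  ring

end Identity

/-! ## §4 Successors of a twisted cylinder are twisted cylinders of successors -/

section Successor

variable {n : ℕ} (q : ℕ) (τ : Fin (n + 1) → ℕ) (a : ℕ) (W : Fin (n + 1) → ℕ) (γ : Fin (n + 1 + 1) → k) (m : ℕ)

/-- `linExp (cylExp _) 0 = 0`. [OURS · L1 W4.3] -/
theorem linExp_cylExp_zero (M : ℕ) : linExp (cylExp M) (0 : Fin M →₀ ℕ) = 0 := by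
  ext j
  refine Fin.lastCases ?_ (fun l => ?_) j
  · rw [linExp_cylExp_last]; rfl
  · rw [linExp_cylExp_castSucc]; rfl

/-- The constant term survives the scaling. [OURS · L1 W4.3] -/
theorem constantCoeff_subst_scaleFam {M : ℕ} (σ : Fin M → ℕ) (f : MvPowerSeries (Fin M) k) :
    constantCoeff (subst (scaleFam (k := k) σ) f) = constantCoeff f := by
  have h := coeff_subst_scaleFam (k := k) σ f 0 0
  rw [linExp_cylExp_zero, zero_add, Finsupp.single_zero, coeff_zero_eq_constantCoeff_apply,
    coeff_zero_eq_constantCoeff_apply, coeff_zero_eq_constantCoeff_apply] at h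
  rw [h, map_pow, map_add, map_one, constantCoeff_X, add_zero, one_pow, mul_one]

/-- Linear coefficients off the idle slot survive the scaling. [OURS · L1 W4.3] -/
theorem coeff_single_castSucc_subst_scaleFam {M : ℕ} (σ : Fin M → ℕ) (f : MvPowerSeries (Fin M) k) (j : Fin M) :
    coeff (Finsupp.single (Fin.castSucc j) 1) (subst (scaleFam (k := k) σ) f) = coeff (Finsupp.single j 1) f := by
  have h := coeff_subst_scaleFam (k := k) σ f (Finsupp.single j 1) 0
  rw [linExp_cylExp_single, Finsupp.single_zero, add_zero] at h
  rw [h, coeff_zero_eq_constantCoeff_apply, map_pow, map_add, map_one, constantCoeff_X, add_zero, one_pow, mul_one]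

/-- Coefficients on the idle axis of a scaled series are multiples of the constant term. [OURS · L1 W4.3] -/
theorem coeff_single_last_subst_scaleFam {M : ℕ} (σ : Fin M → ℕ) (f : MvPowerSeries (Fin M) k) (t : ℕ) :
    coeff (Finsupp.single (Fin.last M) t) (subst (scaleFam (k := k) σ) f) =
      constantCoeff f * coeff (Finsupp.single (Fin.last M) t) ((1 + X (Fin.last M)) ^ (tauDeg σ 0) : MvPowerSeries (Fin (M + 1)) k) := by
  have h := coeff_subst_scaleFam (k := k) σ f 0 t
  rw [linExp_cylExp_zero, zero_add] at h
  rw [h, coeff_zero_eq_constantCoeff_apply]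

/-- A factor `(1 + y)^N` does not change the coefficients off the idle axis… precisely: at exponents with idle slot `0`.
[OURS · L1 W4.3] -/
theorem coeff_one_add_X_pow_mul_of_last_eq_zero {M : ℕ} (N : ℕ) (S : MvPowerSeries (Fin (M + 1)) k) (E : Fin (M + 1) →₀ ℕ)
    (hE : E (Fin.last M) = 0) :
    coeff E (((1 + X (Fin.last M)) ^ N : MvPowerSeries (Fin (M + 1)) k) * S) = coeff E S := by
  classical
  rw [coeff_mul, Finset.sum_eq_single (0, E)]
  · rw [coeff_zero_eq_constantCoeff_apply, map_pow, map_add, map_one, constantCoeff_X, add_zero, one_pow, one_mul]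
  · rintro ⟨e₁, e₂⟩ hmem hne
    have hsum : e₁ + e₂ = E := Finset.HasAntidiagonal.mem_antidiagonal.mp hmem
    by_cases he₁ : coeff e₁ (((1 + X (Fin.last M)) ^ N : MvPowerSeries (Fin (M + 1)) k)) = 0
    · rw [he₁, zero_mul]
    · exfalso
      obtain ⟨s, hs⟩ := exists_eq_single_of_coeff_one_add_X_pow (Fin.last M) N e₁ he₁
      have hs0 : s = 0 := by
        have := DFunLike.congr_fun hsum (Fin.last M)
        rw [Finsupp.add_apply, hs, Finsupp.single_eq_same, hE] at this
        omega
      rw [hs0, Finsupp.single_zero] at hs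
      apply hne
      rw [hs, zero_add] at hsum
      rw [Prod.mk.injEq]
      exact ⟨hs, hsum⟩
  · intro h0
    exact absurd (Finset.HasAntidiagonal.mem_antidiagonal.mpr (zero_add E)) h0

/-- `s ∤ h₁ ⇒ s ∤ h₁(scaleFam σ)` (the exceptional variable is scaled by a unit). [OURS · L1 W4.3] -/
theorem not_X_dvd_subst_scaleFam {M : ℕ} (σ : Fin (M + 1) → ℕ) {f : MvPowerSeries (Fin (M + 1)) k} (hf : ¬ X 0 ∣ f) :
    ¬ X 0 ∣ subst (scaleFam (k := k) σ) f := by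
  rw [X_dvd_iff] at hf ⊢
  push Not at hf ⊢
  obtain ⟨μ, hμ0, hμ⟩ := hf
  refine ⟨linExp (cylExp (M + 1)) μ, ?_, ?_⟩
  · rw [← Fin.castSucc_zero, linExp_cylExp_castSucc]; exact hμ0
  · have h := coeff_subst_scaleFam (k := k) σ f μ 0
    rw [Finsupp.single_zero, add_zero, coeff_zero_eq_constantCoeff_apply, map_pow, map_add, map_one, constantCoeff_X,
      add_zero, one_pow, mul_one] at h
    rw [h]; exact hμ

/-- `s ∤ S ⇒ s ∤ (1+y)^N · S`. [OURS · L1 W4.3] -/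
theorem not_X_dvd_one_add_X_pow_mul {M : ℕ} (N : ℕ) {S : MvPowerSeries (Fin (M + 1 + 1)) k} (hS : ¬ X 0 ∣ S) :
    ¬ X 0 ∣ ((1 + X (Fin.last (M + 1))) ^ N : MvPowerSeries (Fin (M + 1 + 1)) k) * S := by
  have hu : IsUnit (((1 + X (Fin.last (M + 1))) ^ N : MvPowerSeries (Fin (M + 1 + 1)) k)) := by
    refine IsUnit.pow _ ?_
    rw [isUnit_iff_constantCoeff]
    simp [constantCoeff_X]
  exact fun hd => hS (hu.dvd_mul_left.mp hd)

/-- **SUCCESSORS OF A TWISTED CYLINDER ARE TWISTED CYLINDERS OF SUCCESSORS** (move `(id, (W, 0))` vs `(id, W)`, same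
exceptional point on the old coordinates, same exponent; pointwise exact saturation at that point): the game-shaped form.
[OURS · L1 W4.3] -/
theorem isSuccessorAt_of_twistedCyl (hq : 0 < q)
    (h : MvPowerSeries (Fin (n + 1)) k) (G : MvPowerSeries (Fin (n + 1 + 1)) k)
    (hTC : subst (frobFamily (k := k) n q) G = (1 + X (Fin.last (n + 1))) ^ a * subst (scaleFam (k := k) τ) h)
    (hsat : ∀ j, γ (Fin.castSucc j) ≠ 0 → 0 < W j → τ j = m * W j) (hdom : ∀ j, 0 < W j → m * W j ≤ τ j)
    (A : ℕ) (G₁ : MvPowerSeries (Fin (n + 1 + 1 + 1)) k)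
    (hS : IsSuccessorAt G X (Fin.snoc W 0 : Fin (n + 1 + 1) → ℕ) γ A G₁) :
    ∃ h₁ : MvPowerSeries (Fin (n + 1 + 1)) k, IsSuccessorAt h X W (fun l => γ (Fin.castSucc l)) A h₁ ∧
      subst (frobFamily (k := k) (n + 1) q) G₁ =
        (1 + X (Fin.last (n + 1 + 1))) ^ (a + m * A) * subst (scaleFam (k := k) (succTau τ W m)) h₁ := by
  obtain ⟨⟨i', hwi', hci'⟩, hfac, hndvd, hc0, hc1⟩ := hS
  have hF' := hasSubst_frobFamily (k := k) (n := n + 1) q hq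
  have hfr0 : frobFamily (k := k) (n + 1) q 0 = X 0 :=
    frobFamily_of_ne_last q (n + 1) 0 (Fin.castSucc_lt_last (0 : Fin (n + 1 + 1))).ne
  have hXG : subst (X : Fin (n + 1 + 1) → MvPowerSeries (Fin (n + 1 + 1)) k) G = G := by rw [subst_self]; rfl
  have hXh : subst (X : Fin (n + 1) → MvPowerSeries (Fin (n + 1)) k) h = h := by rw [subst_self]; rfl
  rw [hXG] at hfac
  -- the Frobenius pull-back of `G(chart) = s^A · G₁`
  have hfacF : subst (frobFamily (k := k) (n + 1) q)
      (subst (CobordantGame.cruxChart k (Fin.snoc W 0 : Fin (n + 1 + 1) → ℕ) γ) G) =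
        X 0 ^ A * subst (frobFamily (k := k) (n + 1) q) G₁ := by
    rw [hfac, subst_mul hF', subst_pow hF', subst_X hF', hfr0]
  have hndvdF : ¬ X 0 ∣ subst (frobFamily (k := k) (n + 1) q) G₁ := not_X_dvd_subst_frobFamily (n + 1) q hq hndvd
  -- the slice's chart image is non-zero
  set T := subst (CobordantGame.cruxChart k W (fun l => γ (Fin.castSucc l))) h with hT
  have hTne : T ≠ 0 := by
    intro hz
    have h1 := subst_frobFamily_cruxChart_of_twistedCyl q τ a W γ m hq h G hTC hsat hdom 0 0
      (by rw [← hT, hz, pow_zero, mul_zero])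
    rw [hfacF, subst_zero' (hasSubst_scaleFam _), mul_zero, mul_zero] at h1
    rcases mul_eq_zero.mp h1 with h2 | h2
    · exact absurd h2 (pow_ne_zero _ X_zero_ne_zero)
    · exact hndvdF (h2 ▸ dvd_zero _)
  obtain ⟨a₁, h₁, hTfac, hh₁⟩ := CobordantVertexChart.exists_eq_X_pow_mul_not_dvd hTne
  -- the chart identity and uniqueness of the `s`-saturation on the cover
  have hid := subst_frobFamily_cruxChart_of_twistedCyl q τ a W γ m hq h G hTC hsat hdom a₁ h₁ hTfac
  rw [hfacF] at hid
  have hQ : ¬ X 0 ∣ ((1 + X (Fin.last (n + 1 + 1))) ^ (a + m * a₁) * subst (scaleFam (k := k) (succTau τ W m)) h₁) :=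
    not_X_dvd_one_add_X_pow_mul _ (not_X_dvd_subst_scaleFam _ hh₁)
  obtain ⟨hAa, hG₁⟩ := eq_of_X_pow_mul_eq hid hndvdF hQ
  subst hAa
  have hne : i' ≠ Fin.last (n + 1) := by
    rintro rfl
    simp at hwi'
  obtain ⟨l, rfl⟩ := Fin.exists_castSucc_eq.mpr hne
  refine ⟨h₁, ⟨⟨l, by simpa using hwi', hci'⟩, by rw [hXh]; exact hTfac, hh₁, ?_, ?_⟩, hG₁⟩
  · -- constant term
    have h0 := constantCoeff_subst_frobFamily (n + 1) q hq G₁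
    rw [hG₁, map_mul, map_pow, map_add, map_one, constantCoeff_X, add_zero, one_pow, one_mul,
      constantCoeff_subst_scaleFam] at h0
    rw [h0]; exact hc0
  · -- linear terms
    intro j
    have hj := coeff_single_subst_frobFamily_castSucc (n + 1) q hq G₁ j
    rw [hG₁, coeff_one_add_X_pow_mul_of_last_eq_zero _ _ _ (by
        rw [Finsupp.single_apply, if_neg (Fin.castSucc_lt_last j).ne]),
      coeff_single_castSucc_subst_scaleFam] at hj
    rw [hj]; exact hc1 (Fin.castSucc j)

end Successor

end GradedGame

end Summit.ResolutionOfSingularities.ResolutionOfSingularities.Theorems
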